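import Summits.AtomisticToContinuum.Crystallization.Theorems.ReggeStarCoercivityDefectFreeCrystallizesRouteBetaPricedFloor
import Summits.AtomisticToContinuum.Crystallization.Theorems.ReggeStarCoercivityDefectFreeCrystallizesDefectVersion
import Summits.AtomisticToContinuum.Crystallization.Theorems.ReggeStarCoercivityDefectFreeCrystallizesAnnulusCount
import Summits.AtomisticToContinuum.Crystallization.Theorems.ReggeStarCoercivityDefectFreeCrystallizesGoodOfSmallStarDefect
import Summits.AtomisticToContinuum.Crystallization.Theorems.ReggeStarCoercivityDefectFreeCrystallizesGoodOfSmallFccDefect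
import Mathlib.MeasureTheory.Integral.Lebesgue.Markov

/-!
# Route β of line `palm-good-law`, LAW-LEVEL ROBUST FORM (crux `ReggeStarCoercivity.DefectFreeCrystallizes`,
# item stmt-AtomisticToContinuum-13603; lead c8, skeleton v27/v28)

The priced funnel floor (`RouteBetaPricedFloor`, hypothesis `hfloor` there: `hcpE a₀ h₀ + κ·P(bad root shell) ≤ E_P[h]` for every
point-stationary rooted hard-core law a.s. carried by everywhere-`SetGood` Barlow-charted force-balanced configurations with zero mean
virial stress) is reduced, sorry-free, to the line's ONE registered analytic core in its law-level robust form (hypothesis `hcore` below =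
the registered stub `stub_funnelDefectFloor` of the skeleton, verbatim): ENERGY ABOVE THE RELAXED-hcp LEVEL CONTROLS THE MEAN SQUARED STAR
DEFECT, `hcpE a₀ h₀ + κ·E_P[D] ≤ E_P[h]`, where
`D(μ) = min (starDefect a₀ h₀ μ) (⨅_A Σ_(p ∈ fccKissingPattern) infDist(A(a₀ p), rootStar μ)²) + μ{11/10 < ‖y‖ ≤ 5/4}`
(congruence defect of the root star against the nearest rotated relaxed hcp star or rotated regular fcc star of edge `a₀`, plus the
number of atoms squeezed into the annulus), read through any Giry-measurable version `Dm` agreeing with `D` on rooted hard-core configurations.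

WHY law level (lead c8; PICKED.md / LINE-STATUS-c8.md of the crux): the pointwise certificate family of v22–v26 is consumed only at law
level, and "pointwise ⇐ law floor" is a minimax theorem nothing else needs, so the law-level floor is the weaker sufficient core; at law level
the expansion point of a coercivity proof can be the law's invariant mean metric (frame-free, constant along the law).  The robust form is the
natural output of every engine on file (crux 9226's `stub_hcpTubeRigidity` concludes `starDefect = 0` a.s.) and is selection-free.

The three worker-sized inputs are LANDED (lead c8 wave 1): `DefectVersion.stub_defectVersion` (p146247: measurable bounded version of
`μ ↦ ⨅_A Σ_i infDist(A(ref i), rootStar μ)²` for any finite reference family), `AnnulusCount.stub_annulusCount` (p146063: packing bound of the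
annulus mass), `GoodOfSmallStarDefect.stub_goodOfSmallStarDefect` (p146249) and `GoodOfSmallFccDefect.stub_goodOfSmallFccDefect` (p146066)
(small star defect + empty annulus + `SetGood` root ⇒ `1 %`-good root shell, hcp / fcc type).

Main results: `pricedFloor_of_funnelDefectFloor` (robust law-level floor ⇒ priced floor: instantiate the version twice, add the measurable
annulus mass, Markov + `measure_mono_ae`; price `κ/20000`) and `defectFreeCrystallizes_of_funnelDefectFloor` (robust floor → crux 9226 → the crux
BY NAME, through `RouteBetaPricedFloor.defectFreeCrystallizes_of_pricedFloor` p138712): the crux is CLOSED MODULO {`stub_funnelDefectFloor`, crux 9226}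
in the tree.  All `[folklore]` bookkeeping; no definitions.
-/

noncomputable section

open scoped BigOperators ENNReal
open Filter Topology MeasureTheory

namespace Summit.AtomisticToContinuum.Crystallization.Theorems.PalmGoodLaw.RouteBetaDefectFloor

open Summit.AtomisticToContinuum.Crystallization.Theses
open Literature.MathematicalPhysics.StatisticalMechanics Literature.Geometry.DiscreteGeometry
open Literature.Probability.Process

/-- The annulus `11/10 < ‖y‖ ≤ 5/4` is a measurable set (anchor of this file). [folklore] -/
theorem measurableSet_annulus :
    MeasurableSet {y : EuclideanSpace ℝ (Fin 3) | 11 / 10 < ‖y‖ ∧ ‖y‖ ≤ 5 / 4} :=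
  (measurableSet_lt measurable_const measurable_norm).inter (measurableSet_le measurable_norm measurable_const)

/-- **The priced funnel floor FROM THE ROBUST LAW-LEVEL FLOOR (the analytic prover's entry point, lead c8).**  If for the relaxed
reference `(a₀,h₀)` and every hard core `δ > 0` there is `κ > 0` with `hcpE a₀ h₀ + κ·E_P[Dm] ≤ E_P[h]` for every measurable `Dm` agreeing on
rooted `δ`-hard-core configurations with the defect functional `D` (hypothesis `hcore`, verbatim the registered stub `stub_funnelDefectFloor`),
then the priced floor holds with price `κ/20000`: a.s. a bad root shell has `D ≥ 1/20000` (empty annulus ⇒ one of the two star defects is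
small ⇒ the shell is good, p146249 / p146066), the annulus mass and the two star defects have measurable bounded versions (p146063, p146247),
and Markov prices the bad event. [folklore] -/
theorem pricedFloor_of_funnelDefectFloor
    (hcore :
    ∀ a₀ h₀ : ℝ, 189 / 200 ≤ a₀ → a₀ ≤ 199 / 200 → 77 / 100 ≤ h₀ → h₀ ≤ 163 / 200 →
      (∀ a h : ℝ, 0 < a → 0 < h →
        Summit.AtomisticToContinuum.Crystallization.Theorems.PalmUnimodularRigidity.LayeredLawsSelectHcp.hcpE a₀ h₀ ≤
          Summit.AtomisticToContinuum.Crystallization.Theorems.PalmUnimodularRigidity.LayeredLawsSelectHcp.hcpE a h) →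
      ∀ δ : ℝ, 0 < δ → ∃ κ : ℝ, 0 < κ ∧
        ∀ Dm : Measure (EuclideanSpace ℝ (Fin 3)) → ℝ≥0∞, Measurable Dm →
          (∀ μ : Measure (EuclideanSpace ℝ (Fin 3)), IsRootedHardCore δ μ →
            Dm μ = ENNReal.ofReal
              (min (Summit.AtomisticToContinuum.Crystallization.Theorems.PalmUnimodularRigidity.LayeredLawsSelectHcp.starDefect a₀ h₀ μ)
                  (⨅ A : EuclideanSpace ℝ (Fin 3) ≃ₗᵢ[ℝ] EuclideanSpace ℝ (Fin 3),
                    ∑ p ∈ fccKissingPattern, Metric.infDist (A (a₀ • p)) (Summit.AtomisticToContinuum.Crystallization.Theorems.PalmUnimodularRigidity.LayeredLawsSelectHcp.rootStar μ) ^ 2) +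
                (μ {y : EuclideanSpace ℝ (Fin 3) | 11 / 10 < ‖y‖ ∧ ‖y‖ ≤ 5 / 4}).toReal)) →
          ∀ P : Measure (Measure (EuclideanSpace ℝ (Fin 3))), IsProbabilityMeasure P →
            (∀ᵐ μ ∂P, IsRootedHardCore δ μ) → IsPointStationaryLaw P →
            (∀ᵐ μ ∂P, ∃ S : Set (EuclideanSpace ℝ (Fin 3)),
              μ = (Measure.count : Measure (EuclideanSpace ℝ (Fin 3))).restrict S ∧
              (∀ y ∈ S, SetGood S y) ∧
              ∃ s : ℤ → ℤ, IsHaggSeq s ∧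
                ∃ Φ : EuclideanSpace ℝ (Fin 3) → EuclideanSpace ℝ (Fin 3),
                  Set.BijOn Φ (barlowStacking 1 (Real.sqrt (2 / 3)) s) S ∧
                  ∀ p ∈ barlowStacking 1 (Real.sqrt (2 / 3)) s, ∀ q ∈ barlowStacking 1 (Real.sqrt (2 / 3)) s,
                    (dist p q = 1 ↔ (0 < dist (Φ p) (Φ q) ∧ dist (Φ p) (Φ q) < 6 / 5))) →
            (∀ᵐ μ ∂P, ∃ S : Set (EuclideanSpace ℝ (Fin 3)),
              μ = (Measure.count : Measure (EuclideanSpace ℝ (Fin 3))).restrict S ∧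
              ∀ p ∈ S, HasSum (fun q : {q : EuclideanSpace ℝ (Fin 3) // q ∈ S ∧ q ≠ p} =>
                (deriv lennardJones (dist p q.1) / dist p q.1) • (p - q.1)) 0) →
            (∀ M : EuclideanSpace ℝ (Fin 3) →L[ℝ] EuclideanSpace ℝ (Fin 3),
              ∫ μ, (∫ y, deriv lennardJones ‖y‖ / ‖y‖ * inner ℝ y (M y) ∂μ) ∂P = 0) →
            Summit.AtomisticToContinuum.Crystallization.Theorems.PalmUnimodularRigidity.LayeredLawsSelectHcp.hcpE a₀ h₀ +
                κ * (∫⁻ μ, Dm μ ∂P).toReal ≤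
              ∫ μ, (∫ y, lennardJones ‖y‖ ∂μ) / 2 ∂P) :
    ∀ a₀ h₀ : ℝ, 189 / 200 ≤ a₀ → a₀ ≤ 199 / 200 → 77 / 100 ≤ h₀ → h₀ ≤ 163 / 200 →
      (∀ a h : ℝ, 0 < a → 0 < h →
        Summit.AtomisticToContinuum.Crystallization.Theorems.PalmUnimodularRigidity.LayeredLawsSelectHcp.hcpE a₀ h₀ ≤
          Summit.AtomisticToContinuum.Crystallization.Theorems.PalmUnimodularRigidity.LayeredLawsSelectHcp.hcpE a h) →
      ∀ δ : ℝ, 0 < δ → ∃ κ : ℝ, 0 < κ ∧ ∀ P : Measure (Measure (EuclideanSpace ℝ (Fin 3))), IsProbabilityMeasure P →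
        (∀ᵐ μ ∂P, IsRootedHardCore δ μ) → IsPointStationaryLaw P →
        (∀ᵐ μ ∂P, ∃ S : Set (EuclideanSpace ℝ (Fin 3)),
          μ = (Measure.count : Measure (EuclideanSpace ℝ (Fin 3))).restrict S ∧
          (∀ y ∈ S, SetGood S y) ∧
          ∃ s : ℤ → ℤ, IsHaggSeq s ∧
            ∃ Φ : EuclideanSpace ℝ (Fin 3) → EuclideanSpace ℝ (Fin 3),
              Set.BijOn Φ (barlowStacking 1 (Real.sqrt (2 / 3)) s) S ∧
              ∀ p ∈ barlowStacking 1 (Real.sqrt (2 / 3)) s, ∀ q ∈ barlowStacking 1 (Real.sqrt (2 / 3)) s,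
                (dist p q = 1 ↔ (0 < dist (Φ p) (Φ q) ∧ dist (Φ p) (Φ q) < 6 / 5))) →
        (∀ᵐ μ ∂P, ∃ S : Set (EuclideanSpace ℝ (Fin 3)),
          μ = (Measure.count : Measure (EuclideanSpace ℝ (Fin 3))).restrict S ∧
          ∀ p ∈ S, HasSum (fun q : {q : EuclideanSpace ℝ (Fin 3) // q ∈ S ∧ q ≠ p} =>
            (deriv lennardJones (dist p q.1) / dist p q.1) • (p - q.1)) 0) →
        (∀ M : EuclideanSpace ℝ (Fin 3) →L[ℝ] EuclideanSpace ℝ (Fin 3),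
          ∫ μ, (∫ y, deriv lennardJones ‖y‖ / ‖y‖ * inner ℝ y (M y) ∂μ) ∂P = 0) →
        Summit.AtomisticToContinuum.Crystallization.Theorems.PalmUnimodularRigidity.LayeredLawsSelectHcp.hcpE a₀ h₀ +
            κ * (P {μ | ¬ ∃ a : ℝ, 9 / 10 ≤ a ∧ a ≤ 1 ∧ ∃ T : Finset (EuclideanSpace ℝ (Fin 3)),
              (↑T : Set (EuclideanSpace ℝ (Fin 3))) =
                {y : EuclideanSpace ℝ (Fin 3) | μ {y} ≠ 0 ∧ y ≠ 0 ∧ ‖y‖ ≤ 5 / 4 * a} ∧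
              (ShellCloseTo (a / 100) T (Finset.image (fun v : EuclideanSpace ℝ (Fin 3) => a • v) fccKissingPattern) ∨
                ShellCloseTo (a / 100) T
                  (Finset.image (fun v : EuclideanSpace ℝ (Fin 3) => a • v) hcpKissingPattern))}).toReal ≤
          ∫ μ, (∫ y, lennardJones ‖y‖ ∂μ) / 2 ∂P := by
  classical
  intro a₀ h₀ ha₁ ha₂ hh₁ hh₂ hmin δ hδ
  obtain ⟨κ, hκ, hcore⟩ := hcore a₀ h₀ ha₁ ha₂ hh₁ hh₂ hmin δ hδ
  -- measurable versions of the two star defects (stub V, instantiated twice) and the annulus packing bound (stub A)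
  set eH := (Summit.AtomisticToContinuum.Crystallization.Theorems.PalmUnimodularRigidity.LayeredLawsSelectHcp.hcpStarIdx).equivFin with heH
  obtain ⟨Dh, hDh_m, hDh_le, hDh_eq⟩ :=
    DefectVersion.stub_defectVersion _ (fun i => Summit.AtomisticToContinuum.Crystallization.Theorems.PalmUnimodularRigidity.LayeredLawsSelectHcp.hcpSite a₀ h₀ ((eH.symm i : Summit.AtomisticToContinuum.Crystallization.Theorems.PalmUnimodularRigidity.LayeredLawsSelectHcp.hcpStarIdx) : ℤ × ℤ × ℤ)) δ hδ
  set eF := (fccKissingPattern).equivFin with heF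
  obtain ⟨Df, hDf_m, hDf_le, hDf_eq⟩ :=
    DefectVersion.stub_defectVersion _ (fun i => a₀ • ((eF.symm i : fccKissingPattern) : (EuclideanSpace ℝ (Fin 3)))) δ hδ
  obtain ⟨N, hN⟩ := AnnulusCount.stub_annulusCount δ hδ
  -- the annulus event and the measurable version `Dm` of the defect functional
  set ann : Set (EuclideanSpace ℝ (Fin 3)) := {y : (EuclideanSpace ℝ (Fin 3)) | 11 / 10 < ‖y‖ ∧ ‖y‖ ≤ 5 / 4} with hann
  have hann_m : MeasurableSet ann := measurableSet_annulus
  set Dm : Measure (EuclideanSpace ℝ (Fin 3)) → ℝ≥0∞ := fun μ => min (Dh μ) (Df μ) + μ ann with hDm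
  have hDm_m : Measurable Dm := (hDh_m.min hDf_m).add (Measure.measurable_coe hann_m)
  -- read-backs of the two instantiated sums
  have hsumH : ∀ (A : (EuclideanSpace ℝ (Fin 3)) ≃ₗᵢ[ℝ] (EuclideanSpace ℝ (Fin 3))) (μ : Measure (EuclideanSpace ℝ (Fin 3))),
      (∑ i, Metric.infDist (A (Summit.AtomisticToContinuum.Crystallization.Theorems.PalmUnimodularRigidity.LayeredLawsSelectHcp.hcpSite a₀ h₀ ((eH.symm i : Summit.AtomisticToContinuum.Crystallization.Theorems.PalmUnimodularRigidity.LayeredLawsSelectHcp.hcpStarIdx) : ℤ × ℤ × ℤ))) (Summit.AtomisticToContinuum.Crystallization.Theorems.PalmUnimodularRigidity.LayeredLawsSelectHcp.rootStar μ) ^ 2) =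
        ∑ v ∈ Summit.AtomisticToContinuum.Crystallization.Theorems.PalmUnimodularRigidity.LayeredLawsSelectHcp.hcpStarIdx, Metric.infDist (A (Summit.AtomisticToContinuum.Crystallization.Theorems.PalmUnimodularRigidity.LayeredLawsSelectHcp.hcpSite a₀ h₀ v)) (Summit.AtomisticToContinuum.Crystallization.Theorems.PalmUnimodularRigidity.LayeredLawsSelectHcp.rootStar μ) ^ 2 := by
    intro A μ
    rw [← Finset.sum_coe_sort Summit.AtomisticToContinuum.Crystallization.Theorems.PalmUnimodularRigidity.LayeredLawsSelectHcp.hcpStarIdx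
      (fun v : ℤ × ℤ × ℤ => Metric.infDist (A (Summit.AtomisticToContinuum.Crystallization.Theorems.PalmUnimodularRigidity.LayeredLawsSelectHcp.hcpSite a₀ h₀ v)) (Summit.AtomisticToContinuum.Crystallization.Theorems.PalmUnimodularRigidity.LayeredLawsSelectHcp.rootStar μ) ^ 2)]
    exact Fintype.sum_equiv eH.symm _ _ (fun i => rfl)
  have hsumF : ∀ (A : (EuclideanSpace ℝ (Fin 3)) ≃ₗᵢ[ℝ] (EuclideanSpace ℝ (Fin 3))) (μ : Measure (EuclideanSpace ℝ (Fin 3))),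
      (∑ i, Metric.infDist (A (a₀ • ((eF.symm i : fccKissingPattern) : (EuclideanSpace ℝ (Fin 3))))) (Summit.AtomisticToContinuum.Crystallization.Theorems.PalmUnimodularRigidity.LayeredLawsSelectHcp.rootStar μ) ^ 2) =
        ∑ p ∈ fccKissingPattern, Metric.infDist (A (a₀ • p)) (Summit.AtomisticToContinuum.Crystallization.Theorems.PalmUnimodularRigidity.LayeredLawsSelectHcp.rootStar μ) ^ 2 := by
    intro A μ
    rw [← Finset.sum_coe_sort fccKissingPattern
      (fun p : (EuclideanSpace ℝ (Fin 3)) => Metric.infDist (A (a₀ • p)) (Summit.AtomisticToContinuum.Crystallization.Theorems.PalmUnimodularRigidity.LayeredLawsSelectHcp.rootStar μ) ^ 2)]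
    exact Fintype.sum_equiv eF.symm _ _ (fun i => rfl)
  have hstar : ∀ μ : Measure (EuclideanSpace ℝ (Fin 3)), IsRootedHardCore δ μ →
      Dh μ = ENNReal.ofReal (Summit.AtomisticToContinuum.Crystallization.Theorems.PalmUnimodularRigidity.LayeredLawsSelectHcp.starDefect a₀ h₀ μ) := by
    intro μ hμ
    rw [hDh_eq μ hμ]
    simp_rw [hsumH]
    rfl
  have hfcc : ∀ μ : Measure (EuclideanSpace ℝ (Fin 3)), IsRootedHardCore δ μ →
      Df μ = ENNReal.ofReal (⨅ A : (EuclideanSpace ℝ (Fin 3)) ≃ₗᵢ[ℝ] (EuclideanSpace ℝ (Fin 3)),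
        ∑ p ∈ fccKissingPattern, Metric.infDist (A (a₀ • p)) (Summit.AtomisticToContinuum.Crystallization.Theorems.PalmUnimodularRigidity.LayeredLawsSelectHcp.rootStar μ) ^ 2) := by
    intro μ hμ
    rw [hDf_eq μ hμ]
    simp_rw [hsumF]
  have hann_fin : ∀ μ : Measure (EuclideanSpace ℝ (Fin 3)), IsRootedHardCore δ μ → μ ann ≠ ⊤ := fun μ hμ =>
    ne_top_of_le_ne_top (ENNReal.natCast_ne_top N) (hN μ hμ)
  have hfcc_nonneg : ∀ μ : Measure (EuclideanSpace ℝ (Fin 3)), 0 ≤ ⨅ A : (EuclideanSpace ℝ (Fin 3)) ≃ₗᵢ[ℝ] (EuclideanSpace ℝ (Fin 3)),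
      ∑ p ∈ fccKissingPattern, Metric.infDist (A (a₀ • p)) (Summit.AtomisticToContinuum.Crystallization.Theorems.PalmUnimodularRigidity.LayeredLawsSelectHcp.rootStar μ) ^ 2 :=
    fun μ => Real.iInf_nonneg fun _ => Finset.sum_nonneg fun _ _ => sq_nonneg _
  have hagree : ∀ μ : Measure (EuclideanSpace ℝ (Fin 3)), IsRootedHardCore δ μ →
      Dm μ = ENNReal.ofReal
        (min (Summit.AtomisticToContinuum.Crystallization.Theorems.PalmUnimodularRigidity.LayeredLawsSelectHcp.starDefect a₀ h₀ μ)
            (⨅ A : (EuclideanSpace ℝ (Fin 3)) ≃ₗᵢ[ℝ] (EuclideanSpace ℝ (Fin 3)),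
              ∑ p ∈ fccKissingPattern, Metric.infDist (A (a₀ • p)) (Summit.AtomisticToContinuum.Crystallization.Theorems.PalmUnimodularRigidity.LayeredLawsSelectHcp.rootStar μ) ^ 2) +
          (μ {y : (EuclideanSpace ℝ (Fin 3)) | 11 / 10 < ‖y‖ ∧ ‖y‖ ≤ 5 / 4}).toReal) := by
    intro μ hμ
    have hmono : Monotone ENNReal.ofReal := fun _ _ h => ENNReal.ofReal_le_ofReal h
    rw [ENNReal.ofReal_add (le_min (Summit.AtomisticToContinuum.Crystallization.Theorems.PalmUnimodularRigidity.LayeredLawsSelectHcp.starDefect_nonneg a₀ h₀ μ) (hfcc_nonneg μ)) ENNReal.toReal_nonneg,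
      hmono.map_min, ENNReal.ofReal_toReal (hann_fin μ hμ), hDm]
    simp only
    rw [hstar μ hμ, hfcc μ hμ]
  -- the price
  refine ⟨κ * (1 / 20000), by positivity, fun P hP hhc hstat hchart hFB hZS => ?_⟩
  have hfloor := hcore Dm hDm_m hagree P hP hhc hstat hchart hFB hZS
  -- finiteness of `E_P[Dm]`
  have hbound : ∀ᵐ μ ∂P, Dm μ ≤
      ENNReal.ofReal (∑ i, (‖Summit.AtomisticToContinuum.Crystallization.Theorems.PalmUnimodularRigidity.LayeredLawsSelectHcp.hcpSite a₀ h₀ ((eH.symm i : Summit.AtomisticToContinuum.Crystallization.Theorems.PalmUnimodularRigidity.LayeredLawsSelectHcp.hcpStarIdx) : ℤ × ℤ × ℤ)‖ + 11 / 10) ^ 2) + N := by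
    filter_upwards [hhc] with μ hμ
    exact add_le_add ((min_le_left _ _).trans (hDh_le μ)) (hN μ hμ)
  have hfin : ∫⁻ μ, Dm μ ∂P ≠ ⊤ := by
    refine ne_top_of_le_ne_top ?_ (lintegral_mono_ae hbound)
    rw [lintegral_const, measure_univ, mul_one]
    exact ENNReal.add_ne_top.2 ⟨ENNReal.ofReal_ne_top, ENNReal.natCast_ne_top N⟩
  -- bad root shells have defect at least `1/20000` (stubs G_hcp, G_fcc and the annulus clause)
  set bad : Set (Measure (EuclideanSpace ℝ (Fin 3))) := {μ | ¬ ∃ a : ℝ, 9 / 10 ≤ a ∧ a ≤ 1 ∧ ∃ T : Finset (EuclideanSpace ℝ (Fin 3)),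
      (↑T : Set (EuclideanSpace ℝ (Fin 3))) =
        {y : EuclideanSpace ℝ (Fin 3) | μ {y} ≠ 0 ∧ y ≠ 0 ∧ ‖y‖ ≤ 5 / 4 * a} ∧
      (ShellCloseTo (a / 100) T (Finset.image (fun v : EuclideanSpace ℝ (Fin 3) => a • v) fccKissingPattern) ∨
        ShellCloseTo (a / 100) T
          (Finset.image (fun v : EuclideanSpace ℝ (Fin 3) => a • v) hcpKissingPattern))} with hbad
  have hsub : ∀ᵐ μ ∂P, μ ∈ bad → μ ∈ {μ : Measure (EuclideanSpace ℝ (Fin 3)) | ENNReal.ofReal (1 / 20000) ≤ Dm μ} := by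
    filter_upwards [hhc, hchart] with μ hμ hch hμbad
    obtain ⟨S, hμS, hgood, -⟩ := hch
    obtain ⟨S₀, h0, hsep, hμ0⟩ := hμ
    have hmem : ∀ y : (EuclideanSpace ℝ (Fin 3)), y ∈ S ↔ μ {y} ≠ 0 := fun y => by
      rw [hμS]; exact (count_restrict_singleton_ne_zero_iff S y).symm
    have hmem0 : ∀ y : (EuclideanSpace ℝ (Fin 3)), y ∈ S₀ ↔ μ {y} ≠ 0 := fun y => by
      rw [hμ0]; exact (count_restrict_singleton_ne_zero_iff S₀ y).symm
    have h0S : (0 : (EuclideanSpace ℝ (Fin 3))) ∈ S := (hmem 0).2 ((hmem0 0).1 h0)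
    by_contra hlt
    push Not at hlt
    -- `Dm μ < 1/20000`: the annulus is empty and one of the two star defects is small
    have hD := hagree μ ⟨S₀, h0, hsep, hμ0⟩
    rw [hD, ENNReal.ofReal_lt_ofReal_iff (by norm_num : (0 : ℝ) < 1 / 20000)] at hlt
    have hann0 : μ ann = 0 := by
      have hfinS : (ann ∩ S).Finite := by
        rw [← Measure.count_apply_lt_top, ← Measure.restrict_apply hann_m, ← hμS]
        exact lt_top_iff_ne_top.2 (hann_fin μ ⟨S₀, h0, hsep, hμ0⟩)
      have hcard : μ ann = (hfinS.toFinset.card : ℝ≥0∞) := by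
        rw [hμS, Measure.restrict_apply hann_m, Measure.count_apply_finite _ hfinS]
      have hlt1 : (hfinS.toFinset.card : ℝ) < 1 := by
        have h1 : (μ ann).toReal < 1 := by
          have := le_min (Summit.AtomisticToContinuum.Crystallization.Theorems.PalmUnimodularRigidity.LayeredLawsSelectHcp.starDefect_nonneg a₀ h₀ μ) (hfcc_nonneg μ)
          linarith
        rwa [hcard, ENNReal.toReal_natCast] at h1
      have hc0 : hfinS.toFinset.card = 0 := by
        have : hfinS.toFinset.card < 1 := by exact_mod_cast hlt1
        omega
      rw [hcard, hc0, Nat.cast_zero]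
    have hannS : (Measure.count : Measure (EuclideanSpace ℝ (Fin 3))).restrict S {y : (EuclideanSpace ℝ (Fin 3)) | 11 / 10 < ‖y‖ ∧ ‖y‖ ≤ 5 / 4} = 0 := by
      rw [← hμS]; exact hann0
    have hmin_lt : min (Summit.AtomisticToContinuum.Crystallization.Theorems.PalmUnimodularRigidity.LayeredLawsSelectHcp.starDefect a₀ h₀ μ)
        (⨅ A : (EuclideanSpace ℝ (Fin 3)) ≃ₗᵢ[ℝ] (EuclideanSpace ℝ (Fin 3)), ∑ p ∈ fccKissingPattern, Metric.infDist (A (a₀ • p)) (Summit.AtomisticToContinuum.Crystallization.Theorems.PalmUnimodularRigidity.LayeredLawsSelectHcp.rootStar μ) ^ 2) <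
          1 / 20000 := by
      have h1 : (μ ann).toReal = 0 := by rw [hann0, ENNReal.toReal_zero]
      have h2 := hlt
      rw [show (μ {y : (EuclideanSpace ℝ (Fin 3)) | 11 / 10 < ‖y‖ ∧ ‖y‖ ≤ 5 / 4}).toReal = 0 from h1, add_zero] at h2
      exact h2
    apply hμbad
    rcases min_lt_iff.1 hmin_lt with hH | hF
    · -- hcp branch
      rw [hμS] at hH
      obtain ⟨a, ha9, ha1, T, hT, hclose⟩ :=
        GoodOfSmallStarDefect.stub_goodOfSmallStarDefect a₀ h₀ ha₁ ha₂ hh₁ hh₂ hmin S h0S (hgood 0 h0S) hannS hH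
      refine ⟨a, ha9, ha1, T, ?_, Or.inr hclose⟩
      rw [hT, hμS]
    · -- fcc branch
      rw [hμS] at hF
      obtain ⟨a, ha9, ha1, T, hT, hclose⟩ :=
        GoodOfSmallFccDefect.stub_goodOfSmallFccDefect a₀ ha₁ ha₂ S h0S (hgood 0 h0S) hannS hF
      refine ⟨a, ha9, ha1, T, ?_, Or.inl hclose⟩
      rw [hT, hμS]
  -- Markov
  have hM : ENNReal.ofReal (1 / 20000) * P bad ≤ ∫⁻ μ, Dm μ ∂P :=
    (mul_le_mul_right (measure_mono_ae hsub) _).trans (mul_meas_ge_le_lintegral₀ hDm_m.aemeasurable _)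
  have hreal : (1 / 20000 : ℝ) * (P bad).toReal ≤ (∫⁻ μ, Dm μ ∂P).toReal := by
    have := ENNReal.toReal_mono hfin hM
    rwa [ENNReal.toReal_mul, ENNReal.toReal_ofReal (by norm_num : (0 : ℝ) ≤ 1 / 20000)] at this
  have hκmul := mul_le_mul_of_nonneg_left hreal hκ.le
  calc Summit.AtomisticToContinuum.Crystallization.Theorems.PalmUnimodularRigidity.LayeredLawsSelectHcp.hcpE a₀ h₀ + κ * (1 / 20000) * (P bad).toReal
      = Summit.AtomisticToContinuum.Crystallization.Theorems.PalmUnimodularRigidity.LayeredLawsSelectHcp.hcpE a₀ h₀ + κ * ((1 / 20000 : ℝ) * (P bad).toReal) := by ring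
    _ ≤ Summit.AtomisticToContinuum.Crystallization.Theorems.PalmUnimodularRigidity.LayeredLawsSelectHcp.hcpE a₀ h₀ + κ * (∫⁻ μ, Dm μ ∂P).toReal := by linarith
    _ ≤ ∫ μ, (∫ y, lennardJones ‖y‖ ∂μ) / 2 ∂P := hfloor


/-- **Route β composition through the robust floor (no sorry of its own): `stub_funnelDefectFloor` → crux 9226 → the crux BY NAME.**
[folklore] -/
theorem defectFreeCrystallizes_of_funnelDefectFloor
    (hcore :
    ∀ a₀ h₀ : ℝ, 189 / 200 ≤ a₀ → a₀ ≤ 199 / 200 → 77 / 100 ≤ h₀ → h₀ ≤ 163 / 200 →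
      (∀ a h : ℝ, 0 < a → 0 < h →
        Summit.AtomisticToContinuum.Crystallization.Theorems.PalmUnimodularRigidity.LayeredLawsSelectHcp.hcpE a₀ h₀ ≤
          Summit.AtomisticToContinuum.Crystallization.Theorems.PalmUnimodularRigidity.LayeredLawsSelectHcp.hcpE a h) →
      ∀ δ : ℝ, 0 < δ → ∃ κ : ℝ, 0 < κ ∧
        ∀ Dm : Measure (EuclideanSpace ℝ (Fin 3)) → ℝ≥0∞, Measurable Dm →
          (∀ μ : Measure (EuclideanSpace ℝ (Fin 3)), IsRootedHardCore δ μ →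
            Dm μ = ENNReal.ofReal
              (min (Summit.AtomisticToContinuum.Crystallization.Theorems.PalmUnimodularRigidity.LayeredLawsSelectHcp.starDefect a₀ h₀ μ)
                  (⨅ A : EuclideanSpace ℝ (Fin 3) ≃ₗᵢ[ℝ] EuclideanSpace ℝ (Fin 3),
                    ∑ p ∈ fccKissingPattern, Metric.infDist (A (a₀ • p)) (Summit.AtomisticToContinuum.Crystallization.Theorems.PalmUnimodularRigidity.LayeredLawsSelectHcp.rootStar μ) ^ 2) +
                (μ {y : EuclideanSpace ℝ (Fin 3) | 11 / 10 < ‖y‖ ∧ ‖y‖ ≤ 5 / 4}).toReal)) →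
          ∀ P : Measure (Measure (EuclideanSpace ℝ (Fin 3))), IsProbabilityMeasure P →
            (∀ᵐ μ ∂P, IsRootedHardCore δ μ) → IsPointStationaryLaw P →
            (∀ᵐ μ ∂P, ∃ S : Set (EuclideanSpace ℝ (Fin 3)),
              μ = (Measure.count : Measure (EuclideanSpace ℝ (Fin 3))).restrict S ∧
              (∀ y ∈ S, SetGood S y) ∧
              ∃ s : ℤ → ℤ, IsHaggSeq s ∧
                ∃ Φ : EuclideanSpace ℝ (Fin 3) → EuclideanSpace ℝ (Fin 3),
                  Set.BijOn Φ (barlowStacking 1 (Real.sqrt (2 / 3)) s) S ∧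
                  ∀ p ∈ barlowStacking 1 (Real.sqrt (2 / 3)) s, ∀ q ∈ barlowStacking 1 (Real.sqrt (2 / 3)) s,
                    (dist p q = 1 ↔ (0 < dist (Φ p) (Φ q) ∧ dist (Φ p) (Φ q) < 6 / 5))) →
            (∀ᵐ μ ∂P, ∃ S : Set (EuclideanSpace ℝ (Fin 3)),
              μ = (Measure.count : Measure (EuclideanSpace ℝ (Fin 3))).restrict S ∧
              ∀ p ∈ S, HasSum (fun q : {q : EuclideanSpace ℝ (Fin 3) // q ∈ S ∧ q ≠ p} =>
                (deriv lennardJones (dist p q.1) / dist p q.1) • (p - q.1)) 0) →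
            (∀ M : EuclideanSpace ℝ (Fin 3) →L[ℝ] EuclideanSpace ℝ (Fin 3),
              ∫ μ, (∫ y, deriv lennardJones ‖y‖ / ‖y‖ * inner ℝ y (M y) ∂μ) ∂P = 0) →
            Summit.AtomisticToContinuum.Crystallization.Theorems.PalmUnimodularRigidity.LayeredLawsSelectHcp.hcpE a₀ h₀ +
                κ * (∫⁻ μ, Dm μ ∂P).toReal ≤
              ∫ μ, (∫ y, lennardJones ‖y‖ ∂μ) / 2 ∂P)
    (h9226 : PalmUnimodularRigidity.LayeredLawsSelectHcp) :
    Summit.AtomisticToContinuum.Crystallization.Theses.ReggeStarCoercivity.DefectFreeCrystallizes :=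
  RouteBetaPricedFloor.defectFreeCrystallizes_of_pricedFloor (pricedFloor_of_funnelDefectFloor hcore) h9226

end Summit.AtomisticToContinuum.Crystallization.Theorems.PalmGoodLaw.RouteBetaDefectFloor

end
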